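import Summits.BirchSwinnertonDyer.Rank1Residual.Additive.SignedTwistSelmerLayer
import HarnessLib

/-!
# (T-O7ss-P5, file P5-4b) The signed-`η` twist dictionary at the infinite level ((D3)):
# `Θ_∞ (Sel^{−,str}(W/ℚ_∞)) = Sel⁻(V/K₀ℚ_∞)^η`

Cell n1011 (b2b / bsd-rank1-residual), row T-O7ss-P13 follow-up (P5), skeleton
`cells/n1011/skel/T-O7ss-P5.md` §2 (D3); designs (A)/(B) approved (referee-1 GEN 22 ACK-1,
lead R5-69 (m) / R5-71; cc-typer-6 GEN 12 (Q1)–(Q4)).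

HONEST FRAMING. The programme this file serves is a CONDITIONAL ASSEMBLY of the
Birch–Swinnerton-Dyer formula for ALL analytic-rank `≤ 1` elliptic curves over `ℚ` — "full BSD
formula for every rank `≤ 1` curve in class `C`" assembled STRICTLY from published theorems — so
that the rank-`≤ 1` remainder becomes exactly the CONSTRUCTION-SHAPED classes, which are TYPED
(missing-input `Prop`s), NOT attempted. This is not "finishing BSD". Research route on
O7-ss ∩ (G)∧ss ∩ e = 2 (OPEN) / X4 CONSTRUCTION-SHAPED; nothing here is booked; no label moves.
TOOL THEOREMS ONLY: no named Literature fact, no `sorry`; axioms standard; ONE transparent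
`abbrev` (`h1TransportInfty = Θ_{U_∞} ∘ res`, a transport map, not a `Prop`).

Setting (as in P5-1 … P5-4a): `W/ℚ`, `K₀ ∋ θ` with `θ² = c ∈ ℚ`, `θ ∉ ℚ`, `V = C • W^{(c)}`,
`Θ : W[p^∞] ≃+ V[p^∞]` (`geomTransport`) with the sign rule `Θ ∘ σ = η(σ) · σ ∘ Θ`
(`η σ = 1 ↔ σ` fixes `t = rootInClosure K₀ θ`); `κ` a `ℤ_p`-extension of `ℚ`, layers
`ℚ_n = ℚ̄^{L_n}`, `U_n = L_n ⊓ Gal(ℚ̄/K₀)` (`towerSubgroup`), `U_∞ = ker κ ⊓ Gal(ℚ̄/K₀)`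
(`towerTopSubgroup`).

Binders: `hD` = (D0) at `closureEmb E`; `hκ₀` (RESHAPE, P5-2a: `κ(Gal(ℚ̄/K₀)) = ℤ_p`);
`hcop : p ∤ [Γ_ℚ : Gal(ℚ̄/K₀)]`; `[(galRange K₀).Normal]`; `hη`. No `p ≠ 2`, no `IsElliptic`
(binder diff vs. the GEN 6 signature scratch 6d7079126fd5332b: `[W.IsElliptic] [V.IsElliptic]`
DROPPED, `hκ₀` ADDED, `LocalTowerHyp` unfolded as `hD`).

## What is proved
* `h1Transport_resOfLe` (`Θ_*` commutes with restriction), `h1TransportInfty_layerToInfty`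
  (the square `Θ_∞ ∘ layerToInfty n = res_{U_∞ ≤ U_n} ∘ Θ_n`), `h1TransportInfty_conjH1`
  (`Θ_∞ ∘ conj_g = η(g)·conj_g ∘ Θ_∞`), `conjH1_h1TransportInfty_of_mem_ker` (the image of `Θ_∞`
  is `η`-EIGEN under `ker κ`);
* `map_h1TransportInfty_strictSignedSelmerInfty_le` (⊆: (D2) at each layer + the square);
* the **η-average** `A = Σ_{q ∈ ker κ/U_∞} η(q̃)·conj_{q̃}` (representatives `q̃ ∈ ker κ`, which are
  simultaneously representatives of every `L_n/U_n`, `exists_equiv_kerQuotient_layerQuotient`):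
  `sum_eta_smul_conjH1_h1Transport` (on the `W`-side the signs CANCEL: `A ∘ Θ = Θ ∘ Σ conj`),
  `conjH1_sum_conjH1_of_bijective` (a norm over a full set of representatives is invariant),
  `relIndex_towerTop_ker_dvd`;
* `h1TransportInfty_injective` (`p ∤ [ker κ : U_∞]`).
The ⊇ half and (D3) itself (`map_h1TransportInfty_strictSignedSelmerInfty`) follow in the sequel
file `SignedTwistSelmerInftyEta.lean` (split for the 400-line rule).

References: S. Kobayashi, Invent. Math. 152 (2003) Def. 2.1, §4 p. 8 (`M^η = ε_η M`)
[Kobayashi2003]; T. & V. Dokchitser, Ann. of Math. 172 (2010) Lemma 4.14 (proof)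
[DokchitserDokchitserAnnals2010]; R. Greenberg, LNM 1716 (1999) §5 p. 143 [GreenbergLNM1716].
-/

noncomputable section

open scoped Classical

open WeierstrassCurve Field

namespace Summit.BirchSwinnertonDyer.Rank1Residual.Additive.SignedTwist

open Literature.NumberTheory.EllipticCurves Literature.NumberTheory.GaloisRepresentations
  Literature.NumberTheory.EllipticCurves.Kobayashi2003
  Summit.BirchSwinnertonDyer.Rank1Residual.AdditivePotMult ZpExtension

variable (W : WeierstrassCurve ℚ) (K₀ : Type) [Field K₀] [NumberField K₀] {θ : K₀} {c : ℚ}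
  (hθ : θ ∉ Set.range (algebraMap ℚ K₀)) (hc : θ ^ 2 = algebraMap ℚ K₀ c)
  (p : ℕ) [Fact p.Prime] (κ : ZpExtension ℚ p)
  {V : WeierstrassCurve ℚ} {C : VariableChange ℚ} (hCV : C • W.quadraticTwist c = V)
  (E : Type) [Field E] [Algebra ℚ E]
  (η : absoluteGaloisGroup ℚ →* ℤˣ)
  (hη : ∀ σ : absoluteGaloisGroup ℚ, η σ = 1 ↔ σ • rootInClosure K₀ θ = rootInClosure K₀ θ)

/-! ## §1 `Θ_∞` and its bookkeeping -/

omit [Fact p.Prime] in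
/-- **Restriction commutes with the transport**: `Θ_* (res_{H ≤ H'} y) = res_{H ≤ H'} (Θ_* y)`
(both are `[Θ ∘ f ∘ incl]` on cocycles). [cite: Kobayashi2003, §2 p. 4] -/
theorem h1Transport_resOfLe {H H' : Subgroup (absoluteGaloisGroup ℚ)} (h : H ≤ H')
    (hH : H ≤ galRange (K := ℚ) K₀) (hH' : H' ≤ galRange (K := ℚ) K₀) (y : W.subgroupH1 p H') :
    h1Transport W K₀ hθ hc p hCV H hH (W.resOfLe p h y) =
      V.resOfLe p h (h1Transport W K₀ hθ hc p hCV H' hH' y) := by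
  obtain ⟨f, rfl⟩ := oneCocycleClass_surjective _ y
  rw [resOfLe_oneCocycleClass, h1Equiv_apply, h1Equiv_apply,
    Literature.NumberTheory.EllipticCurves.resH1Hom_id_oneCocycleClass,
    Literature.NumberTheory.EllipticCurves.resH1Hom_id_oneCocycleClass, resOfLe_oneCocycleClass]
  rfl

/-- **`Θ_∞ : H¹(ℚ_∞, W[p^∞]) → H¹(K₀ℚ_∞, V[p^∞])`** = restriction to `U_∞ = Gal(ℚ̄/K₀ℚ_∞)` followed
by the transport `Θ_*` (P5-1b `h1Transport`; a transparent abbreviation).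
[cite: Kobayashi2003, §2 p. 4] -/
abbrev h1TransportInfty : W.subgroupH1 p κ.kerSubgroup →+ V.subgroupH1 p (towerTopSubgroup κ K₀) :=
  (h1Transport W K₀ hθ hc p hCV (towerTopSubgroup κ K₀) inf_le_right :
      W.subgroupH1 p (towerTopSubgroup κ K₀) →+ V.subgroupH1 p (towerTopSubgroup κ K₀)).comp
    (W.resOfLe p (towerTopSubgroup_le_kerSubgroup κ K₀))

/-- **The square**: `Θ_∞ (layerToInfty n x) = res_{U_∞ ≤ U_n} (Θ_n x)` (transitivity of
restriction + `h1Transport_resOfLe`). [cite: Kobayashi2003, §2 p. 4] -/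
theorem h1TransportInfty_layerToInfty (n : ℕ) (x : W.subgroupH1 p (κ.layerSubgroup n)) :
    h1TransportInfty W K₀ hθ hc p κ hCV (W.layerToInfty κ n x) =
      V.resOfLe p (towerTopSubgroup_le κ K₀ n) (h1TransportLayer W K₀ hθ hc p κ hCV n x) := by
  have h1 := towerSubgroup_le_layerSubgroup K₀ p κ n
  have h2 := towerTopSubgroup_le κ K₀ n
  show h1Transport W K₀ hθ hc p hCV (towerTopSubgroup κ K₀) inf_le_right
      (W.resOfLe p (towerTopSubgroup_le_kerSubgroup κ K₀)
        (W.resOfLe p (κ.kerSubgroup_le_layerSubgroup n) x)) =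
    V.resOfLe p h2 (h1Transport W K₀ hθ hc p hCV (towerSubgroup κ K₀ n)
      (towerSubgroup_le_galRange κ K₀ n) (W.resOfLe p h1 x))
  rw [← AddMonoidHom.comp_apply (W.resOfLe p (towerTopSubgroup_le_kerSubgroup κ K₀))
      (W.resOfLe p (κ.kerSubgroup_le_layerSubgroup n)), W.resOfLe_comp_holds p,
    ← h1Transport_resOfLe W K₀ hθ hc p hCV h2 inf_le_right (towerSubgroup_le_galRange κ K₀ n),
    ← AddMonoidHom.comp_apply (W.resOfLe p h2) (W.resOfLe p h1), W.resOfLe_comp_holds p]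

include hη in
/-- **The η-sign rule at the top**: `Θ_∞ (conj_g s) = η(g) · conj_g (Θ_∞ s)` for every `g ∈ Γ_ℚ`.
[cite: Kobayashi2003, §4 p. 8] -/
theorem h1TransportInfty_conjH1 [(galRange (K := ℚ) K₀).Normal] (g : absoluteGaloisGroup ℚ)
    (s : W.subgroupH1 p κ.kerSubgroup) :
    h1TransportInfty W K₀ hθ hc p κ hCV (W.conjH1 p κ.kerSubgroup g s) =
      ((η g : ℤˣ) : ℤ) • V.conjH1 p (towerTopSubgroup κ K₀) g
        (h1TransportInfty W K₀ hθ hc p κ hCV s) := by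
  have hle := towerTopSubgroup_le_kerSubgroup κ K₀
  rw [AddMonoidHom.comp_apply, AddMonoidHom.comp_apply, ← AddMonoidHom.comp_apply (W.resOfLe p hle),
    show (W.resOfLe p hle).comp (W.conjH1 p κ.kerSubgroup g) =
      (W.conjH1 p (towerTopSubgroup κ K₀) g).comp (W.resOfLe p hle) from
      resOfLe_comp_conjH1_holds (M := W.geomPrimaryTorsion p) hle g,
    AddMonoidHom.comp_apply, AddMonoidHom.coe_coe, h1Transport_conjH1 W K₀ hθ hc p hCV η hη]

include hη in
/-- **The image of `Θ_∞` is `η`-eigen under `ker κ`**: for `σ ∈ Gal(ℚ̄/ℚ_∞)`,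
`conj_σ (Θ_∞ s) = η(σ) · Θ_∞ s` (`σ` acts trivially on `H¹(ℚ_∞, ·)`, `conjH1_of_mem_holds`, and
`η(σ)² = 1`). [cite: Kobayashi2003, §4 p. 8 (M^η = ε_η M)] -/
theorem conjH1_h1TransportInfty_of_mem_ker [(galRange (K := ℚ) K₀).Normal]
    {σ : absoluteGaloisGroup ℚ} (hσ : σ ∈ κ.kerSubgroup) (s : W.subgroupH1 p κ.kerSubgroup) :
    V.conjH1 p (towerTopSubgroup κ K₀) σ (h1TransportInfty W K₀ hθ hc p κ hCV s) =
      ((η σ : ℤˣ) : ℤ) • h1TransportInfty W K₀ hθ hc p κ hCV s := by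
  have key := h1TransportInfty_conjH1 W K₀ hθ hc p κ hCV η hη σ s
  rw [W.conjH1_of_mem_holds p κ.kerSubgroup hσ, AddMonoidHom.id_apply] at key
  conv_rhs => rw [key]
  rw [units_smul_units_smul]

/-! ## §2 `Θ_∞ (Sel^{−,str}(W/ℚ_∞)) ⊆ Sel⁻(V/K₀ℚ_∞)^η` -/

include hη in
/-- **(D3, ⊆)**: `Θ_∞` maps `Sel^{−,str}(W/ℚ_∞) = ⋃_n layerToInfty_n Sel^{−,str}(W/ℚ_n)` into
`Sel⁻(V/K₀ℚ_∞)^η`: layer by layer by (D2) and the square, `η`-eigen by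
`conjH1_h1TransportInfty_of_mem_ker`. [cite: Kobayashi2003, Def. 2.1 (p. 5), §4 p. 8] -/
theorem map_h1TransportInfty_strictSignedSelmerInfty_le [(galRange (K := ℚ) K₀).Normal]
    (hD : ∀ g : absoluteGaloisGroup ℚ, ∃ τ : absoluteGaloisGroup E,
      (resGalOfEmb (closureEmb (K := ℚ) E) τ)⁻¹ * g ∈ towerTopSubgroup κ K₀)
    (hκ₀ : ∀ x, ∃ g ∈ galRange (K := ℚ) K₀, κ g = x)
    (hcop : (galRange (K := ℚ) K₀).index.Coprime p) :
    (strictSignedSelmerInfty W κ E (-1)).map (h1TransportInfty W K₀ hθ hc p κ hCV) ≤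
      towerSignedSelmerInftyEta V κ K₀ E η (-1) := by
  rw [AddSubgroup.map_le_iff_le_comap]
  refine (iSup_le fun n ↦ ?_ :
    (⨆ n : ℕ, (strictSignedSelmerLayer W κ E (-1) n).map (W.layerToInfty κ n)) ≤ _)
  rw [AddSubgroup.map_le_iff_le_comap]
  intro x hx
  rw [AddSubgroup.mem_comap, AddSubgroup.mem_comap, mem_towerSignedSelmerInftyEta_iff]
  refine ⟨?_, fun σ hσ ↦ conjH1_h1TransportInfty_of_mem_ker W K₀ hθ hc p κ hCV η hη hσ _⟩
  rw [h1TransportInfty_layerToInfty]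
  exact map_resOfLe_towerSignedSelmerLayer_le V κ K₀ E (-1) n
    ⟨_, (mem_strictSignedSelmerLayer_iff_h1TransportLayer W K₀ hθ hc p κ hCV E η hη hD hκ₀ hcop
      n x).mp hx, rfl⟩

/-! ## §3 The `η`-average -/

omit [Fact p.Prime] in
include hη in
/-- **On the `W`-side the signs cancel**: `Σ_i η(r_i)·conj_{r_i} (Θ_* y) = Θ_* (Σ_i conj_{r_i} y)`
(`Θ_* conj = η · conj Θ_*` and `η² = 1`). [cite: Kobayashi2003, §4 p. 8 (ε_η)] -/
theorem sum_eta_smul_conjH1_h1Transport {ι : Type*} [Fintype ι] (r : ι → absoluteGaloisGroup ℚ)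
    (H : Subgroup (absoluteGaloisGroup ℚ)) [H.Normal] (hH : H ≤ galRange (K := ℚ) K₀)
    (y : W.subgroupH1 p H) :
    ∑ i, ((η (r i) : ℤˣ) : ℤ) • V.conjH1 p H (r i) (h1Transport W K₀ hθ hc p hCV H hH y) =
      h1Transport W K₀ hθ hc p hCV H hH (∑ i, W.conjH1 p H (r i) y) := by
  rw [map_sum]
  refine Finset.sum_congr rfl fun i _ ↦ ?_
  rw [h1Transport_conjH1 W K₀ hθ hc p hCV η hη]

omit [Fact p.Prime] in
/-- **A norm over a full set of representatives is invariant**: if `i ↦ r_i·A` is a bijection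
`ι → B/A` (`A ≤ B`, `A` normal), then `conj_g (Σ_i conj_{r_i} y) = Σ_i conj_{r_i} y` on `H¹(A, ·)`
for every `g ∈ B` (`g` permutes the cosets; `A` acts trivially, `conjH1_of_mem_holds`).
[cite: DokchitserDokchitserAnnals2010, Lemma 4.14 (proof)] -/
theorem conjH1_sum_conjH1_of_bijective {ι : Type*} [Fintype ι]
    {A B : Subgroup (absoluteGaloisGroup ℚ)} [A.Normal] (r : ι → absoluteGaloisGroup ℚ)
    (hr : ∀ i, r i ∈ B)
    (hbij : Function.Bijective fun i ↦
      (QuotientGroup.mk (⟨r i, hr i⟩ : B) : B ⧸ A.subgroupOf B))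
    (g : B) (y : W.subgroupH1 p A) :
    W.conjH1 p A (g : absoluteGaloisGroup ℚ) (∑ i, W.conjH1 p A (r i) y) =
      ∑ i, W.conjH1 p A (r i) y := by
  obtain ⟨e, he⟩ : ∃ e : ι ≃ B ⧸ A.subgroupOf B,
      ∀ i, e i = QuotientGroup.mk (⟨r i, hr i⟩ : B) :=
    ⟨Equiv.ofBijective _ hbij, fun _ ↦ rfl⟩
  let π : ι ≃ ι :=
    e.trans ((Equiv.mulLeft (QuotientGroup.mk g : B ⧸ A.subgroupOf B)).trans e.symm)
  have hπ : ∀ i, (r (π i))⁻¹ * ((g : absoluteGaloisGroup ℚ) * r i) ∈ A := fun i ↦ by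
    have h1 : e (π i) = QuotientGroup.mk (g * ⟨r i, hr i⟩) := by
      have h0 : e (π i) = (QuotientGroup.mk g : B ⧸ A.subgroupOf B) * e i := by
        simp only [π, Equiv.trans_apply, Equiv.coe_mulLeft, Equiv.apply_symm_apply]
      rw [h0, he i, ← QuotientGroup.mk_mul]
    rw [he (π i), QuotientGroup.eq, Subgroup.mem_subgroupOf] at h1
    exact h1
  rw [map_sum, ← Equiv.sum_comp π (fun i ↦ W.conjH1 p A (r i) y)]
  refine Finset.sum_congr rfl fun i _ ↦ ?_
  have hgr : (g : absoluteGaloisGroup ℚ) * r i =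
      r (π i) * ((r (π i))⁻¹ * ((g : absoluteGaloisGroup ℚ) * r i)) := by group
  rw [← AddMonoidHom.comp_apply, ← W.conjH1_mul_holds p A, hgr, W.conjH1_mul_holds p A,
    AddMonoidHom.comp_apply, W.conjH1_of_mem_holds p A (hπ i), AddMonoidHom.id_apply]

/-- **Representatives of `ker κ / U_∞` are representatives of every `L_n / U_n`**: under
`κ(Gal(ℚ̄/K₀)) = ℤ_p` the inclusion `ker κ ≤ L_n` induces a bijection
`ker κ / U_∞ ≃ L_n / U_n` (`Gal(K₀ℚ_∞/ℚ_∞) = Gal(K₀ℚ_n/ℚ_n)`), compatible with `QuotientGroup.mk`.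
[cite: Kobayashi2003, §2 p. 4 (the tower K_n = K₀ℚ_n)] -/
theorem exists_equiv_kerQuotient_layerQuotient (hκ₀ : ∀ x, ∃ g ∈ galRange (K := ℚ) K₀, κ g = x)
    (n : ℕ) :
    ∃ e : κ.kerSubgroup ⧸ (towerTopSubgroup κ K₀).subgroupOf κ.kerSubgroup ≃
        κ.layerSubgroup n ⧸ (towerSubgroup κ K₀ n).subgroupOf (κ.layerSubgroup n),
      ∀ k : κ.kerSubgroup, e (QuotientGroup.mk k) =
        QuotientGroup.mk (Subgroup.inclusion (κ.kerSubgroup_le_layerSubgroup n) k) := by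
  have hle := κ.kerSubgroup_le_layerSubgroup n
  have h1 : (towerTopSubgroup κ K₀).subgroupOf κ.kerSubgroup =
      (galRange (K := ℚ) K₀).subgroupOf κ.kerSubgroup :=
    Subgroup.inf_subgroupOf_left _ _
  have h2 : (galRange (K := ℚ) K₀).subgroupOf (κ.layerSubgroup n) =
      (towerSubgroup κ K₀ n).subgroupOf (κ.layerSubgroup n) :=
    (Subgroup.inf_subgroupOf_left _ _).symm
  let f : κ.kerSubgroup ⧸ (towerTopSubgroup κ K₀).subgroupOf κ.kerSubgroup →
      κ.layerSubgroup n ⧸ (towerSubgroup κ K₀ n).subgroupOf (κ.layerSubgroup n) :=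
    fun q ↦ Subgroup.quotientEquivOfEq h2
      (Subgroup.quotientSubgroupOfEmbeddingOfLE (galRange (K := ℚ) K₀) hle
        (Subgroup.quotientEquivOfEq h1 q))
  have hf : ∀ k, f (QuotientGroup.mk k) = QuotientGroup.mk (Subgroup.inclusion hle k) := fun k ↦ by
    simp only [f, Subgroup.quotientEquivOfEq_mk, Subgroup.quotientSubgroupOfEmbeddingOfLE_apply_mk]
  have hinj : Function.Injective f :=
    (Subgroup.quotientEquivOfEq h2).injective.comp
      ((Subgroup.quotientSubgroupOfEmbeddingOfLE _ hle).injective.comp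
        (Subgroup.quotientEquivOfEq h1).injective)
  have hsurj : Function.Surjective f := by
    intro q
    obtain ⟨a, rfl⟩ := QuotientGroup.mk_surjective q
    obtain ⟨g, hgK, hga⟩ := hκ₀ (κ (a : absoluteGaloisGroup ℚ))
    have hk : (a : absoluteGaloisGroup ℚ) * g⁻¹ ∈ κ.kerSubgroup := by
      rw [mem_kerSubgroup, map_mul, map_inv, hga, mul_inv_cancel]
    refine ⟨QuotientGroup.mk ⟨_, hk⟩, ?_⟩
    rw [hf, QuotientGroup.eq, Subgroup.mem_subgroupOf, mem_towerSubgroup_iff]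
    have hg : (((Subgroup.inclusion hle ⟨_, hk⟩)⁻¹ * a : κ.layerSubgroup n) :
        absoluteGaloisGroup ℚ) = g := by
      show ((a : absoluteGaloisGroup ℚ) * g⁻¹)⁻¹ * a = g
      group
    rw [hg]
    refine ⟨?_, hgK⟩
    rw [mem_layerSubgroup, hga]
    exact mem_layerSubgroup.mp a.2
  exact ⟨Equiv.ofBijective f ⟨hinj, hsurj⟩, hf⟩

/-- `[ker κ : U_∞] ∣ [Γ_ℚ : Gal(ℚ̄/K₀)]`. [folklore] -/
theorem relIndex_towerTop_ker_dvd [(galRange (K := ℚ) K₀).Normal] :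
    (towerTopSubgroup κ K₀).relIndex κ.kerSubgroup ∣ (galRange (K := ℚ) K₀).index := by
  rw [show towerTopSubgroup κ K₀ = κ.kerSubgroup ⊓ galRange (K := ℚ) K₀ from rfl,
    Subgroup.inf_relIndex_left]
  exact Subgroup.relIndex_dvd_index_of_normal _ _
/-! ## §4 Injectivity of `Θ_∞` -/

/-- **`Θ_∞` is injective** for `p ∤ [Γ_ℚ : Gal(ℚ̄/K₀)]`: `Θ_*` is an isomorphism and the kernel of
`res : H¹(ℚ_∞, W[p^∞]) → H¹(K₀ℚ_∞, W[p^∞])` is killed by `[ker κ : U_∞] ∣ [Γ:G₀]`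
(`relIndex_nsmul_eq_zero_of_resOfLe_eq_zero_rel`) on a `p`-primary group.
[cite: GreenbergLNM1716, §5 p. 143] -/
theorem h1TransportInfty_injective [(galRange (K := ℚ) K₀).Normal]
    (hcop : (galRange (K := ℚ) K₀).index.Coprime p) :
    Function.Injective (h1TransportInfty W K₀ hθ hc p κ hCV) := by
  have hle := towerTopSubgroup_le_kerSubgroup κ K₀
  haveI hFI : ((towerTopSubgroup κ K₀).subgroupOf κ.kerSubgroup).FiniteIndex :=
    ⟨fun h0 ↦ Subgroup.FiniteIndex.index_ne_zero (H := galRange (K := ℚ) K₀)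
      (Nat.eq_zero_of_zero_dvd ((show (towerTopSubgroup κ K₀).relIndex κ.kerSubgroup = 0
        from h0) ▸ relIndex_towerTop_ker_dvd K₀ p κ))⟩
  have hopen : IsOpen (((towerTopSubgroup κ K₀).subgroupOf κ.kerSubgroup :
      Subgroup κ.kerSubgroup) : Set κ.kerSubgroup) :=
    isOpen_subgroupOf_of_eq_inf (isOpen_galRange K₀) rfl
  rw [injective_iff_map_eq_zero]
  intro s hs
  rw [AddMonoidHom.comp_apply, AddMonoidHom.coe_coe, EmbeddingLike.map_eq_zero_iff] at hs
  have hkill := relIndex_nsmul_eq_zero_of_resOfLe_eq_zero_rel (W.geomPrimaryTorsion p) hle hopen hs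
  obtain ⟨j, hj⟩ := exists_pow_nsmul_eq_zero_subgroupH1_of_isClosed W p κ.isClosed_kerSubgroup s
  have h := mem_of_coprime_nsmul_mem p (⊥ : AddSubgroup (W.subgroupH1 p κ.kerSubgroup)) hj
    (Nat.Coprime.coprime_dvd_left (relIndex_towerTop_ker_dvd K₀ p κ) hcop)
    (by rw [hkill]; exact zero_mem _)
  exact (AddSubgroup.mem_bot).mp h

end Summit.BirchSwinnertonDyer.Rank1Residual.Additive.SignedTwist

end
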